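import Mathlib
import Summits.KontsevichZagierPeriods.Zeta5Search.FamB5Z6
import Summits.KontsevichZagierPeriods.Zeta5Search.Atlas.FamilyCellB6
import HarnessLib

/-!
# ζ(5) search — `CellAtlas.FamilyCellB` IS A THEOREM (HONEST FRAMING: systematic search; no irrationality claim unless certified)

Cell `pub-zeta5`, GEN-2 seat generation 19.  Census g11's family cell B of the consecutive family `bFam t n = n·(3t+8; t+6,…,t)`
(`RecordCellAtlas.FamilyCellB`: for every `t ≥ 5`, `n ≥ 2` and prime `(t+1)n < p < (t+3/2)n`, `v_p(Cas₇(bFam t n)) ≥ −6`; observed 43/43,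
`t = 11` is the record cell `RecordCellB`) from its two halves (`FamilyCellBSplit.lean`):
* `t ≥ 6`: `Atlas.FamilyCellB6.holds` — the AFFINE mechanism (`CellKit.affine_bound_typed`, `N = 5`), P1 g8's atlas machine run by gen-2 g19;
* `t = 5`: `FamB5Z6.familyCellBAt5_holds` — the ZERO-REGIME type-space window `M = 6` of the ray `n·(23; 11,…,5)` (`TypeSpaceLawZero`, a theorem;
  class structure `FamB5ZeroClassesZ6` by gen-2's window machine).
With `FamilyCellA` (P1 g5) and `FamilyCellD` (P1 g7/g8) this makes all three census family cells of the record's ray tree theorems, uniformly in `t`.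
`p`-adic bookkeeping of rational numbers; nothing here bears on irrationality (the records table is unchanged).
-/

noncomputable section

namespace Summit.KontsevichZagierPeriods.Zeta5Search.CellAtlas

/-- **`FamilyCellB` IS A THEOREM**: for every `t ≥ 5`, `n ≥ 2` and prime `p` with `(t+1)n < p` and `2p < (2t+3)n`,
`Cas₇(bFam t n) ≠ 0 → v_p(Cas₇(bFam t n)) ≥ −6`. -/
theorem familyCellB_holds : FamilyCellB :=
  FamilyTiers.familyCellB_of_split FamB5Z6.familyCellBAt5_holds Atlas.FamilyCellB6.holds

end Summit.KontsevichZagierPeriods.Zeta5Search.CellAtlas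

end
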